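import Summits.Ventures.YMGap.RobustBall.FiniteGibbsInfluence
import HarnessLib

/-!
# RobustBall/FiniteGibbsInfluenceV — one-site influences of an exponential-sum weight with PER-SITE VARIATION bounds:
# `tv ≤ ½ ∑_{p ∋ x, y} δ_p(y)`

HONEST FRAMING: elementary finite combinatorics (finite sums only, no measure theory), written for the LINK-ROW form of the
centre-tube area law of track Y2 (cell `pub-ymgap`, seat ds-4 g9).  It is `FiniteGibbsInfluenceW.tv_le_of_exp_sum_weighted`
(gen 8: each term `φ_p` bounded by ONE constant `A_p`, so that changing a spin moves it by `≤ 2A_p`) with the sharper datum of a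
VARIATION bound `δ_p(y)` PER TERM AND PER SITE: for `w σ = exp(∑_p φ_p σ)`, `φ_p` reading only `links p`, and
`|φ_p σ − φ_p τ| ≤ δ_p(y)` whenever `σ, τ` agree off `y`, changing the spin at `y ≠ x` moves the one-site law at `x` by at most
`½ ∑_{p : x ∈ links p ∧ y ∈ links p} δ_p(y)` in total variation (only terms through BOTH sites matter; the log-ratio of the two
conditional weights has oscillation `≤ 2 ∑ δ_p(y)`; sharp tilt bound `tv_le_quarter_of_osc`).  With `δ_p ≡ 2A_p` this is the gen-8
bound.  The point: for a twist defect `W_X(ζ_k U) − W_X(U)` the variation in the twist at one link is the single-link oscillation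
(or `2√N ×` the Frobenius-Lipschitz constant) of `W_X` at that link — a per-link load the robust balls already carry — whereas its
sup bound is the total oscillation of `W_X`.  Nothing is specific to gauge theories; nothing is claimed about any continuum limit.

References: Georgii 2011 Prop. 8.8 and (8.27); Simon 1993 §V.1 (Dobrushin coefficients of finite-range interactions).
-/

noncomputable section

open Finset Function Real

namespace Summit.Ventures.YMGap.RobustBall.FiniteGibbs

variable {V S : Type*} [DecidableEq V] [Fintype S] [Nonempty S]

/-- **One-site influences of an exponential-sum weight with per-site variation bounds.**  Let `w σ = exp(∑_p φ_p σ)` where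
each `φ_p` reads only the spins in `links p` and `|φ_p σ − φ_p τ| ≤ δ_p(y)` whenever `σ, τ` agree off `y`.  If `σ, τ` agree off
`y`, the one-site laws at `x` satisfy `tv w x σ τ ≤ ½ ∑_{p : x ∈ links p ∧ y ∈ links p} δ_p(y)`.
[cite: Georgii2011, Prop. 8.8] -/
theorem tv_le_of_exp_sum_var {P : Type*} [Fintype P] (links : P → Finset V) (φ : P → (V → S) → ℝ)
    (hdep : ∀ p, DependsOn (φ p) (↑(links p) : Set V)) (δ : P → V → ℝ)
    (hδ : ∀ (p : P) (y : V) (σ τ : V → S), (∀ z, z ≠ y → σ z = τ z) → |φ p σ - φ p τ| ≤ δ p y)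
    {w : (V → S) → ℝ} (hw : ∀ σ, w σ = Real.exp (∑ p, φ p σ)) {x y : V}
    {σ τ : V → S} (hστ : ∀ z, z ≠ y → σ z = τ z) [DecidablePred fun p => x ∈ links p ∧ y ∈ links p] :
    tv w x σ τ ≤ (∑ p ∈ Finset.univ.filter (fun p => x ∈ links p ∧ y ∈ links p), δ p y) / 2 := by
  have hwpos : ∀ σ, 0 < w σ := fun σ => by rw [hw]; exact Real.exp_pos _
  set Q := Finset.univ.filter fun p => x ∈ links p ∧ y ∈ links p with hQ
  -- the log-ratio of the two conditional weights
  set h : S → ℝ := fun s => ∑ p, (φ p (update τ x s) - φ p (update σ x s)) with hh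
  have hwh : ∀ s, w (update τ x s) = w (update σ x s) * Real.exp (h s) := fun s => by
    rw [hw, hw, ← Real.exp_add]
    congr 1
    rw [hh]; dsimp only
    rw [Finset.sum_sub_distrib]; ring
  -- the updated configurations still agree off `y`
  have hagree : ∀ s, ∀ z, z ≠ y → update τ x s z = update σ x s z := fun s =>
    update_agree_of_agree (fun z hz => (hστ z hz).symm) s
  -- terms through both sites: variation ≤ 2 δ_p(y); other terms: constant in `s`
  have hterm : ∀ (p : P) (s s' : S),
      (φ p (update τ x s) - φ p (update σ x s)) - (φ p (update τ x s') - φ p (update σ x s')) ≤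
        if x ∈ links p ∧ y ∈ links p then 2 * δ p y else 0 := by
    intro p s s'
    split_ifs with hp
    · have h1 := abs_le.1 (hδ p y (update τ x s) (update σ x s) (hagree s))
      have h2 := abs_le.1 (hδ p y (update τ x s') (update σ x s') (hagree s'))
      linarith [h1.1, h1.2, h2.1, h2.2]
    · rw [not_and_or] at hp
      rcases hp with hx | hy
      · have hzx : ∀ z ∈ (↑(links p) : Set V), z ≠ x := fun z hz h => hx (h ▸ Finset.mem_coe.1 hz)
        have eτ : φ p (update τ x s) = φ p (update τ x s') :=
          hdep p fun z hz => by rw [update_of_ne (hzx z hz), update_of_ne (hzx z hz)]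
        have eσ : φ p (update σ x s) = φ p (update σ x s') :=
          hdep p fun z hz => by rw [update_of_ne (hzx z hz), update_of_ne (hzx z hz)]
        rw [eτ, eσ]; simp
      · have e1 : φ p (update τ x s) = φ p (update σ x s) :=
          hdep p fun z hz => (update_agree_of_agree hστ s z (fun h => hy (h ▸ Finset.mem_coe.1 hz))).symm
        have e2 : φ p (update τ x s') = φ p (update σ x s') :=
          hdep p fun z hz => (update_agree_of_agree hστ s' z (fun h => hy (h ▸ Finset.mem_coe.1 hz))).symm
        rw [e1, e2]; simp
  have hsumQ : ∑ p, (if x ∈ links p ∧ y ∈ links p then 2 * δ p y else 0) = 2 * ∑ p ∈ Q, δ p y := by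
    rw [Finset.sum_ite, Finset.sum_const_zero, add_zero, ← hQ, Finset.mul_sum]
  have hD : ∀ s s', h s - h s' ≤ 2 * ∑ p ∈ Q, δ p y := by
    intro s s'
    have hhs : h s - h s' = ∑ p, ((φ p (update τ x s) - φ p (update σ x s)) -
        (φ p (update τ x s') - φ p (update σ x s'))) := by
      rw [hh]; dsimp only; rw [← Finset.sum_sub_distrib]
    rw [hhs, ← hsumQ]
    exact Finset.sum_le_sum fun p _ => hterm p s s'
  calc tv w x σ τ ≤ (2 * ∑ p ∈ Q, δ p y) / 4 := tv_le_quarter_of_osc hwpos x σ τ hD hwh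
    _ = (∑ p ∈ Q, δ p y) / 2 := by ring

end Summit.Ventures.YMGap.RobustBall.FiniteGibbs

end
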